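import Summits.Parity.GeneralizedHardyLittlewood.Theorems.PrimeLevelFamEdgeMomentsBeyondDiagonalDiagRemThreeThreeBose
import HarnessLib

/-!
# Route `PrimeLevelFamEdge`, crux K_A `MomentsBeyondDiagonal` (stmt-Parity-20007), line «petersson_layers» v4, stub `stub_diag`:
# **the continued Bose remainders `r₃₄, r₄₀, r₄₁, r₄₂, r₄₃, r₄₄` of ORDER `(4,4)` in `Π`-form (moments `μ₂, μ₄, μ₆, μ₈` explicit),
# two-sequence Abel estimate with the common envelope `9C₀(1+|log 2αY²|)¹⁰`** (first bricks of the remainder estimate (R₄₄))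

The order-`(4,4)` piece of `stub_diag` (top order of rung `N = 4`; rung 4 ⟸ order (4,4) alone by `…DiagRungFourOfTarget44`) will be reduced
to (Poly₄₄) + a remainder estimate (R₄₄) carrying the TWENTY-FIVE kernels `r_ab`, `a, b ≤ 4`. Nineteen are in the tree in `Π`-form
(`…DiagRemThreeThreeKernelsAll.twoSeq_sixteen₃₃`: `a, b ≤ 3`; `…DiagRemZeroFourBose` / `…DiagRemTwoFourBose`: `r₀₄, r₁₄, r₂₄`). This file adds
the six missing ones from the generic `…DiagRemBoseTwoSeq.abs_doubleSum_bose_rem_le₂ a b` (odd moments cancel; `μ_m = ∫₀¹logᵐv·v/(1+v²)²`):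

* `envelope_aux10`, `weaken_second_term10` — the common envelope `9C₀x¹⁰` (`a + b + 1 ≤ 9`);
* `abs_doubleSum_rem_le₄₄b` — **`Π₃₄ = Π₄₃ = −L⁸/2048 + (μ₂/32)L⁶ − (3μ₄/16)L⁴ + (μ₆/2)L²`, `Π₄₀ = L⁵/160 + μ₂L³ + 2μ₄L`,
  `Π₄₁ = −L⁶/384 − (μ₂/8)L⁴ + (3μ₄/2)L²`, `Π₄₂ = L⁷/896 − (μ₂/40)L⁵ − (μ₄/6)L³ + 2μ₆L`,
  `Π₄₄ = L⁹/4608 − (μ₂/56)L⁷ + (3μ₄/20)L⁵ − (2μ₆/3)L³ + 2μ₈L`** — six two-sequence Abel estimates with common `C₀`.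

Def-free; theorems only. Helper `--supports stmt-Parity-20007`; closes nothing (the bundle of the 25 kernels, bricks B3–B5 of (R₄₄), the
(4,4) polynomial chain and `stub_rung/core/band/farP` remain); K_A, K_B and the Parity summit are NOT proved; nothing about Landau–Siegel zeros.

## References
* E. Kowalski, P. Michel, J. VanderKam, J. reine angew. Math. 526 (2000), (22)–(28) pp. 12–15 and Prop. 5.1 p. 18.
  [cite: KowalskiMichelVanderKam2000, (22)–(28) and Prop. 5.1 — derivation (corner of the diagonal, general Q, order (4,4))]
-/

noncomputable section

open Real MeasureTheory Finset

namespace Summit.Parity.GeneralizedHardyLittlewood.Theorems.MomentsBeyondDiagonal.DiagCorner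

open Summit.Parity.GeneralizedHardyLittlewood.Theorems.BeyondDiagonalBeatsQuarter.Corner
open Summit.Parity.GeneralizedHardyLittlewood.Theorems.MomentsBeyondDiagonal.DiagLines

/-- `3(C₀ + C₀x^N) + 2C₀ + C₀x^N·x ≤ 9C₀x¹⁰` for `C₀ ≥ 0`, `x ≥ 1`, `N ≤ 9`. [folklore] -/
theorem envelope_aux10 {C₀ x : ℝ} (hC : 0 ≤ C₀) (hx : 1 ≤ x) {N : ℕ} (hN : N ≤ 9) :
    3 * (C₀ + C₀ * x ^ N) + 2 * C₀ + C₀ * x ^ N * x ≤ 9 * C₀ * x ^ 10 := by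
  have h4 : 1 ≤ x ^ 10 := one_le_pow₀ hx
  have hN4 : x ^ N ≤ x ^ 10 := pow_le_pow_right₀ hx (by omega)
  have hN1 : x ^ N * x ≤ x ^ 10 := by
    rw [← pow_succ]; exact pow_le_pow_right₀ hx (by omega)
  nlinarith [mul_le_mul_of_nonneg_left h4 hC, mul_le_mul_of_nonneg_left hN4 hC,
    mul_le_mul_of_nonneg_left hN1 hC]

/-- Weakening of the second term of the two-sequence estimate to the common envelope `9C₀(1+|log(2αY²)|)¹⁰`
(`N ≤ 9`). [folklore] -/
theorem weaken_second_term10 {S T Sj η L C₀ x : ℝ} {i N : ℕ} (hSj : 0 ≤ Sj) (hη : 0 ≤ η) (hL : 0 ≤ L)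
    (hC : 0 ≤ C₀) (hx : 1 ≤ x) (hN : N ≤ 9)
    (h : S ≤ T + Sj * ((2 * η) * (L ^ i * (3 * (C₀ + C₀ * x ^ N) + 2 * C₀ + C₀ * x ^ N * x)))) :
    S ≤ T + Sj * ((2 * η) * (L ^ i * (9 * C₀ * x ^ 10))) := by
  have hw := envelope_aux10 hC hx hN
  have : Sj * ((2 * η) * (L ^ i * (3 * (C₀ + C₀ * x ^ N) + 2 * C₀ + C₀ * x ^ N * x))) ≤
      Sj * ((2 * η) * (L ^ i * (9 * C₀ * x ^ 10))) := by
    have hLi : 0 ≤ L ^ i := pow_nonneg hL i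
    gcongr
  linarith

set_option maxHeartbeats 3200000 in
-- six large kernel statements
/-- **THE CONTINUED BOSE REMAINDERS `r₃₄, r₄₀, r₄₁, r₄₂, r₄₃, r₄₄` IN `Π`-FORM (moments `μ₂, μ₄, μ₆, μ₈` explicit), TWO-SEQUENCE ABEL
ESTIMATE WITH THE COMMON ENVELOPE `9C₀(1+|log 2αY²|)¹⁰`.**
[cite: KowalskiMichelVanderKam2000, (22)–(28) and Prop. 5.1 — derivation (corner of the diagonal, general Q, order (4,4))] -/
theorem abs_doubleSum_rem_le₄₄b : ∃ E₃₄ E₄₀ E₄₁ E₄₂ E₄₃ E₄₄ C₀ : ℝ, 0 ≤ C₀ ∧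
    ∀ (a₁ a₂ : ℕ → ℝ) (Y α B η : ℝ) (K₁ i j : ℕ), 1 ≤ Y → 0 < α → 1 ≤ i → 1 ≤ j →
      (∀ e : ℕ, e ≤ ⌊Y⌋₊ → |∑ k ∈ Icc 1 e, a₂ k| ≤ B) → (∀ e : ℕ, K₁ ≤ e → |∑ k ∈ Icc 1 e, a₁ k| ≤ η) →
      2 * α * K₁ * Y ≤ 1 →
    |∑ k₁ ∈ Icc 1 ⌊Y⌋₊, ∑ k₂ ∈ Icc 1 ⌊Y⌋₊,
        a₁ k₁ * a₂ k₂ * ellp Y k₁ ^ i * ellp Y k₂ ^ j *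
          ((∫ u₁ in Set.Ioi (0 : ℝ), Real.log u₁ ^ 3 * ∫ u₂ in Set.Ioi ((α * k₁ * k₂) / u₁),
              Real.exp (-(u₁ + u₂)) / (1 - Real.exp (-(u₁ + u₂))) ^ 2 * Real.log u₂ ^ 4) -
            (-(Real.log (1 / (α * k₁ * k₂)) ^ 8) / 2048 + (∫ v in Set.Ioc (0 : ℝ) 1, Real.log v ^ 2 * (v / (1 + v ^ 2) ^ 2)) / 32 * Real.log (1 / (α * k₁ * k₂)) ^ 6 - 3 * (∫ v in Set.Ioc (0 : ℝ) 1, Real.log v ^ 4 * (v / (1 + v ^ 2) ^ 2)) / 16 * Real.log (1 / (α * k₁ * k₂)) ^ 4 + (∫ v in Set.Ioc (0 : ℝ) 1, Real.log v ^ 6 * (v / (1 + v ^ 2) ^ 2)) / 2 * Real.log (1 / (α * k₁ * k₂)) ^ 2 + E₃₄))| ≤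
      (∑ k ∈ Icc 1 ⌊Y⌋₊, |a₁ k| * ellp Y k ^ i) * (B * (Real.log Y ^ j * (3 * C₀ * Real.sqrt (2 * α * K₁ * Y)))) +
        (∑ k ∈ Icc 1 ⌊Y⌋₊, |a₂ k| * ellp Y k ^ j) *
          ((2 * η) * (Real.log Y ^ i * (9 * C₀ * (1 + |Real.log (2 * α * Y ^ 2)|) ^ 10))) ∧
    |∑ k₁ ∈ Icc 1 ⌊Y⌋₊, ∑ k₂ ∈ Icc 1 ⌊Y⌋₊,
        a₁ k₁ * a₂ k₂ * ellp Y k₁ ^ i * ellp Y k₂ ^ j *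
          ((∫ u₁ in Set.Ioi (0 : ℝ), Real.log u₁ ^ 4 * ∫ u₂ in Set.Ioi ((α * k₁ * k₂) / u₁),
              Real.exp (-(u₁ + u₂)) / (1 - Real.exp (-(u₁ + u₂))) ^ 2) -
            (Real.log (1 / (α * k₁ * k₂)) ^ 5 / 160 + (∫ v in Set.Ioc (0 : ℝ) 1, Real.log v ^ 2 * (v / (1 + v ^ 2) ^ 2)) * Real.log (1 / (α * k₁ * k₂)) ^ 3 + 2 * (∫ v in Set.Ioc (0 : ℝ) 1, Real.log v ^ 4 * (v / (1 + v ^ 2) ^ 2)) * Real.log (1 / (α * k₁ * k₂)) + E₄₀))| ≤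
      (∑ k ∈ Icc 1 ⌊Y⌋₊, |a₁ k| * ellp Y k ^ i) * (B * (Real.log Y ^ j * (3 * C₀ * Real.sqrt (2 * α * K₁ * Y)))) +
        (∑ k ∈ Icc 1 ⌊Y⌋₊, |a₂ k| * ellp Y k ^ j) *
          ((2 * η) * (Real.log Y ^ i * (9 * C₀ * (1 + |Real.log (2 * α * Y ^ 2)|) ^ 10))) ∧
    |∑ k₁ ∈ Icc 1 ⌊Y⌋₊, ∑ k₂ ∈ Icc 1 ⌊Y⌋₊,
        a₁ k₁ * a₂ k₂ * ellp Y k₁ ^ i * ellp Y k₂ ^ j *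
          ((∫ u₁ in Set.Ioi (0 : ℝ), Real.log u₁ ^ 4 * ∫ u₂ in Set.Ioi ((α * k₁ * k₂) / u₁),
              Real.exp (-(u₁ + u₂)) / (1 - Real.exp (-(u₁ + u₂))) ^ 2 * Real.log u₂) -
            (-(Real.log (1 / (α * k₁ * k₂)) ^ 6) / 384 - (∫ v in Set.Ioc (0 : ℝ) 1, Real.log v ^ 2 * (v / (1 + v ^ 2) ^ 2)) / 8 * Real.log (1 / (α * k₁ * k₂)) ^ 4 + 3 * (∫ v in Set.Ioc (0 : ℝ) 1, Real.log v ^ 4 * (v / (1 + v ^ 2) ^ 2)) / 2 * Real.log (1 / (α * k₁ * k₂)) ^ 2 + E₄₁))| ≤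
      (∑ k ∈ Icc 1 ⌊Y⌋₊, |a₁ k| * ellp Y k ^ i) * (B * (Real.log Y ^ j * (3 * C₀ * Real.sqrt (2 * α * K₁ * Y)))) +
        (∑ k ∈ Icc 1 ⌊Y⌋₊, |a₂ k| * ellp Y k ^ j) *
          ((2 * η) * (Real.log Y ^ i * (9 * C₀ * (1 + |Real.log (2 * α * Y ^ 2)|) ^ 10))) ∧
    |∑ k₁ ∈ Icc 1 ⌊Y⌋₊, ∑ k₂ ∈ Icc 1 ⌊Y⌋₊,
        a₁ k₁ * a₂ k₂ * ellp Y k₁ ^ i * ellp Y k₂ ^ j *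
          ((∫ u₁ in Set.Ioi (0 : ℝ), Real.log u₁ ^ 4 * ∫ u₂ in Set.Ioi ((α * k₁ * k₂) / u₁),
              Real.exp (-(u₁ + u₂)) / (1 - Real.exp (-(u₁ + u₂))) ^ 2 * Real.log u₂ ^ 2) -
            (Real.log (1 / (α * k₁ * k₂)) ^ 7 / 896 - (∫ v in Set.Ioc (0 : ℝ) 1, Real.log v ^ 2 * (v / (1 + v ^ 2) ^ 2)) / 40 * Real.log (1 / (α * k₁ * k₂)) ^ 5 - (∫ v in Set.Ioc (0 : ℝ) 1, Real.log v ^ 4 * (v / (1 + v ^ 2) ^ 2)) / 6 * Real.log (1 / (α * k₁ * k₂)) ^ 3 + 2 * (∫ v in Set.Ioc (0 : ℝ) 1, Real.log v ^ 6 * (v / (1 + v ^ 2) ^ 2)) * Real.log (1 / (α * k₁ * k₂)) + E₄₂))| ≤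
      (∑ k ∈ Icc 1 ⌊Y⌋₊, |a₁ k| * ellp Y k ^ i) * (B * (Real.log Y ^ j * (3 * C₀ * Real.sqrt (2 * α * K₁ * Y)))) +
        (∑ k ∈ Icc 1 ⌊Y⌋₊, |a₂ k| * ellp Y k ^ j) *
          ((2 * η) * (Real.log Y ^ i * (9 * C₀ * (1 + |Real.log (2 * α * Y ^ 2)|) ^ 10))) ∧
    |∑ k₁ ∈ Icc 1 ⌊Y⌋₊, ∑ k₂ ∈ Icc 1 ⌊Y⌋₊,
        a₁ k₁ * a₂ k₂ * ellp Y k₁ ^ i * ellp Y k₂ ^ j *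
          ((∫ u₁ in Set.Ioi (0 : ℝ), Real.log u₁ ^ 4 * ∫ u₂ in Set.Ioi ((α * k₁ * k₂) / u₁),
              Real.exp (-(u₁ + u₂)) / (1 - Real.exp (-(u₁ + u₂))) ^ 2 * Real.log u₂ ^ 3) -
            (-(Real.log (1 / (α * k₁ * k₂)) ^ 8) / 2048 + (∫ v in Set.Ioc (0 : ℝ) 1, Real.log v ^ 2 * (v / (1 + v ^ 2) ^ 2)) / 32 * Real.log (1 / (α * k₁ * k₂)) ^ 6 - 3 * (∫ v in Set.Ioc (0 : ℝ) 1, Real.log v ^ 4 * (v / (1 + v ^ 2) ^ 2)) / 16 * Real.log (1 / (α * k₁ * k₂)) ^ 4 + (∫ v in Set.Ioc (0 : ℝ) 1, Real.log v ^ 6 * (v / (1 + v ^ 2) ^ 2)) / 2 * Real.log (1 / (α * k₁ * k₂)) ^ 2 + E₄₃))| ≤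
      (∑ k ∈ Icc 1 ⌊Y⌋₊, |a₁ k| * ellp Y k ^ i) * (B * (Real.log Y ^ j * (3 * C₀ * Real.sqrt (2 * α * K₁ * Y)))) +
        (∑ k ∈ Icc 1 ⌊Y⌋₊, |a₂ k| * ellp Y k ^ j) *
          ((2 * η) * (Real.log Y ^ i * (9 * C₀ * (1 + |Real.log (2 * α * Y ^ 2)|) ^ 10))) ∧
    |∑ k₁ ∈ Icc 1 ⌊Y⌋₊, ∑ k₂ ∈ Icc 1 ⌊Y⌋₊,
        a₁ k₁ * a₂ k₂ * ellp Y k₁ ^ i * ellp Y k₂ ^ j *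
          ((∫ u₁ in Set.Ioi (0 : ℝ), Real.log u₁ ^ 4 * ∫ u₂ in Set.Ioi ((α * k₁ * k₂) / u₁),
              Real.exp (-(u₁ + u₂)) / (1 - Real.exp (-(u₁ + u₂))) ^ 2 * Real.log u₂ ^ 4) -
            (Real.log (1 / (α * k₁ * k₂)) ^ 9 / 4608 - (∫ v in Set.Ioc (0 : ℝ) 1, Real.log v ^ 2 * (v / (1 + v ^ 2) ^ 2)) / 56 * Real.log (1 / (α * k₁ * k₂)) ^ 7 + 3 * (∫ v in Set.Ioc (0 : ℝ) 1, Real.log v ^ 4 * (v / (1 + v ^ 2) ^ 2)) / 20 * Real.log (1 / (α * k₁ * k₂)) ^ 5 - 2 * (∫ v in Set.Ioc (0 : ℝ) 1, Real.log v ^ 6 * (v / (1 + v ^ 2) ^ 2)) / 3 * Real.log (1 / (α * k₁ * k₂)) ^ 3 + 2 * (∫ v in Set.Ioc (0 : ℝ) 1, Real.log v ^ 8 * (v / (1 + v ^ 2) ^ 2)) * Real.log (1 / (α * k₁ * k₂)) + E₄₄))| ≤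
      (∑ k ∈ Icc 1 ⌊Y⌋₊, |a₁ k| * ellp Y k ^ i) * (B * (Real.log Y ^ j * (3 * C₀ * Real.sqrt (2 * α * K₁ * Y)))) +
        (∑ k ∈ Icc 1 ⌊Y⌋₊, |a₂ k| * ellp Y k ^ j) *
          ((2 * η) * (Real.log Y ^ i * (9 * C₀ * (1 + |Real.log (2 * α * Y ^ 2)|) ^ 10))) := by
  obtain ⟨C₃₄, hC₃₄, h₃₄⟩ := abs_doubleSum_bose_rem_le₂ 3 4
  obtain ⟨C₄₀, hC₄₀, h₄₀⟩ := abs_doubleSum_bose_rem_le₂ 4 0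
  obtain ⟨C₄₁, hC₄₁, h₄₁⟩ := abs_doubleSum_bose_rem_le₂ 4 1
  obtain ⟨C₄₂, hC₄₂, h₄₂⟩ := abs_doubleSum_bose_rem_le₂ 4 2
  obtain ⟨C₄₃, hC₄₃, h₄₃⟩ := abs_doubleSum_bose_rem_le₂ 4 3
  obtain ⟨C₄₄, hC₄₄, h₄₄⟩ := abs_doubleSum_bose_rem_le₂ 4 4
  set C₀ : ℝ := max (max (max C₃₄ C₄₀) (max C₄₁ C₄₂)) (max C₄₃ C₄₄) with hC₀
  have e₃₄ : C₃₄ ≤ C₀ := ((le_max_left _ _).trans (le_max_left _ _)).trans (le_max_left _ _)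
  have e₄₀ : C₄₀ ≤ C₀ := ((le_max_right _ _).trans (le_max_left _ _)).trans (le_max_left _ _)
  have e₄₁ : C₄₁ ≤ C₀ := ((le_max_left _ _).trans (le_max_right _ _)).trans (le_max_left _ _)
  have e₄₂ : C₄₂ ≤ C₀ := ((le_max_right _ _).trans (le_max_right _ _)).trans (le_max_left _ _)
  have e₄₃ : C₄₃ ≤ C₀ := (le_max_left _ _).trans (le_max_right _ _)
  have e₄₄ : C₄₄ ≤ C₀ := (le_max_right _ _).trans (le_max_right _ _)
  have hC₀0 : 0 ≤ C₀ := hC₃₄.trans e₃₄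
  refine ⟨((∫ u₁ in Set.Ioi (0 : ℝ), Real.log u₁ ^ 3 * ∫ u₂ in Set.Ioi (1 / u₁),
        Real.exp (-(u₁ + u₂)) / (1 - Real.exp (-(u₁ + u₂))) ^ 2 * Real.log u₂ ^ 4) +
      (∫ η in Set.Ioc (0 : ℝ) 1, (η * (∫ u in Set.Ioi (0 : ℝ), Real.log u ^ 3 * Real.log (η / u) ^ 4 *
            (Real.exp (-(u + η / u)) / (1 - Real.exp (-(u + η / u))) ^ 2) / u) -
          ∫ v in Set.Ioc (0 : ℝ) 1, ((-(Real.log (1 / η) / 2) + Real.log v) ^ 3 * (-(Real.log (1 / η) / 2) - Real.log v) ^ 4 +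
              (-(Real.log (1 / η) / 2) - Real.log v) ^ 3 * (-(Real.log (1 / η) / 2) + Real.log v) ^ 4) *
            (v / (1 + v ^ 2) ^ 2)) / η)),
    ((∫ u₁ in Set.Ioi (0 : ℝ), Real.log u₁ ^ 4 * ∫ u₂ in Set.Ioi (1 / u₁),
        Real.exp (-(u₁ + u₂)) / (1 - Real.exp (-(u₁ + u₂))) ^ 2 * Real.log u₂ ^ 0) +
      (∫ η in Set.Ioc (0 : ℝ) 1, (η * (∫ u in Set.Ioi (0 : ℝ), Real.log u ^ 4 * Real.log (η / u) ^ 0 *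
            (Real.exp (-(u + η / u)) / (1 - Real.exp (-(u + η / u))) ^ 2) / u) -
          ∫ v in Set.Ioc (0 : ℝ) 1, ((-(Real.log (1 / η) / 2) + Real.log v) ^ 4 * (-(Real.log (1 / η) / 2) - Real.log v) ^ 0 +
              (-(Real.log (1 / η) / 2) - Real.log v) ^ 4 * (-(Real.log (1 / η) / 2) + Real.log v) ^ 0) *
            (v / (1 + v ^ 2) ^ 2)) / η)),
    ((∫ u₁ in Set.Ioi (0 : ℝ), Real.log u₁ ^ 4 * ∫ u₂ in Set.Ioi (1 / u₁),
        Real.exp (-(u₁ + u₂)) / (1 - Real.exp (-(u₁ + u₂))) ^ 2 * Real.log u₂ ^ 1) +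
      (∫ η in Set.Ioc (0 : ℝ) 1, (η * (∫ u in Set.Ioi (0 : ℝ), Real.log u ^ 4 * Real.log (η / u) ^ 1 *
            (Real.exp (-(u + η / u)) / (1 - Real.exp (-(u + η / u))) ^ 2) / u) -
          ∫ v in Set.Ioc (0 : ℝ) 1, ((-(Real.log (1 / η) / 2) + Real.log v) ^ 4 * (-(Real.log (1 / η) / 2) - Real.log v) ^ 1 +
              (-(Real.log (1 / η) / 2) - Real.log v) ^ 4 * (-(Real.log (1 / η) / 2) + Real.log v) ^ 1) *
            (v / (1 + v ^ 2) ^ 2)) / η)),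
    ((∫ u₁ in Set.Ioi (0 : ℝ), Real.log u₁ ^ 4 * ∫ u₂ in Set.Ioi (1 / u₁),
        Real.exp (-(u₁ + u₂)) / (1 - Real.exp (-(u₁ + u₂))) ^ 2 * Real.log u₂ ^ 2) +
      (∫ η in Set.Ioc (0 : ℝ) 1, (η * (∫ u in Set.Ioi (0 : ℝ), Real.log u ^ 4 * Real.log (η / u) ^ 2 *
            (Real.exp (-(u + η / u)) / (1 - Real.exp (-(u + η / u))) ^ 2) / u) -
          ∫ v in Set.Ioc (0 : ℝ) 1, ((-(Real.log (1 / η) / 2) + Real.log v) ^ 4 * (-(Real.log (1 / η) / 2) - Real.log v) ^ 2 +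
              (-(Real.log (1 / η) / 2) - Real.log v) ^ 4 * (-(Real.log (1 / η) / 2) + Real.log v) ^ 2) *
            (v / (1 + v ^ 2) ^ 2)) / η)),
    ((∫ u₁ in Set.Ioi (0 : ℝ), Real.log u₁ ^ 4 * ∫ u₂ in Set.Ioi (1 / u₁),
        Real.exp (-(u₁ + u₂)) / (1 - Real.exp (-(u₁ + u₂))) ^ 2 * Real.log u₂ ^ 3) +
      (∫ η in Set.Ioc (0 : ℝ) 1, (η * (∫ u in Set.Ioi (0 : ℝ), Real.log u ^ 4 * Real.log (η / u) ^ 3 *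
            (Real.exp (-(u + η / u)) / (1 - Real.exp (-(u + η / u))) ^ 2) / u) -
          ∫ v in Set.Ioc (0 : ℝ) 1, ((-(Real.log (1 / η) / 2) + Real.log v) ^ 4 * (-(Real.log (1 / η) / 2) - Real.log v) ^ 3 +
              (-(Real.log (1 / η) / 2) - Real.log v) ^ 4 * (-(Real.log (1 / η) / 2) + Real.log v) ^ 3) *
            (v / (1 + v ^ 2) ^ 2)) / η)),
    ((∫ u₁ in Set.Ioi (0 : ℝ), Real.log u₁ ^ 4 * ∫ u₂ in Set.Ioi (1 / u₁),
        Real.exp (-(u₁ + u₂)) / (1 - Real.exp (-(u₁ + u₂))) ^ 2 * Real.log u₂ ^ 4) +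
      (∫ η in Set.Ioc (0 : ℝ) 1, (η * (∫ u in Set.Ioi (0 : ℝ), Real.log u ^ 4 * Real.log (η / u) ^ 4 *
            (Real.exp (-(u + η / u)) / (1 - Real.exp (-(u + η / u))) ^ 2) / u) -
          ∫ v in Set.Ioc (0 : ℝ) 1, ((-(Real.log (1 / η) / 2) + Real.log v) ^ 4 * (-(Real.log (1 / η) / 2) - Real.log v) ^ 4 +
              (-(Real.log (1 / η) / 2) - Real.log v) ^ 4 * (-(Real.log (1 / η) / 2) + Real.log v) ^ 4) *
            (v / (1 + v ^ 2) ^ 2)) / η)),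
    C₀, hC₀0, fun a₁ a₂ Y α B η K₁ i j hY hα hi hj hB hη hY₁ ↦ ?_⟩
  have hY0 : 0 < Y := by linarith
  have hη0 : 0 ≤ η := (abs_nonneg _).trans (hη K₁ le_rfl)
  have hLY : 0 ≤ Real.log Y := Real.log_nonneg hY
  have hx : (1 : ℝ) ≤ 1 + |Real.log (2 * α * Y ^ 2)| := by linarith [abs_nonneg (Real.log (2 * α * Y ^ 2))]
  have hSj : 0 ≤ ∑ k ∈ Icc 1 ⌊Y⌋₊, |a₂ k| * ellp Y k ^ j :=
    Finset.sum_nonneg fun k _ ↦ mul_nonneg (abs_nonneg _) (pow_nonneg (ellp_nonneg Y k) j)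
  have hSi : 0 ≤ ∑ k ∈ Icc 1 ⌊Y⌋₊, |a₁ k| * ellp Y k ^ i :=
    Finset.sum_nonneg fun k _ ↦ mul_nonneg (abs_nonneg _) (pow_nonneg (ellp_nonneg Y k) i)
  have hB0 : 0 ≤ B := (abs_nonneg _).trans (hB 0 (Nat.zero_le _))
  have hsq : 0 ≤ Real.sqrt (2 * α * K₁ * Y) := Real.sqrt_nonneg _
  have hc32 : Nat.choose 3 2 = 3 := by decide
  have hc42 : Nat.choose 4 2 = 6 := by decide
  have hc43 : Nat.choose 4 3 = 4 := by decide
  have hfirst : ∀ {C : ℝ}, C ≤ C₀ →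
      (∑ k ∈ Icc 1 ⌊Y⌋₊, |a₁ k| * ellp Y k ^ i) * (B * (Real.log Y ^ j * (3 * C * Real.sqrt (2 * α * K₁ * Y)))) ≤
      (∑ k ∈ Icc 1 ⌊Y⌋₊, |a₁ k| * ellp Y k ^ i) * (B * (Real.log Y ^ j * (3 * C₀ * Real.sqrt (2 * α * K₁ * Y)))) := by
    intro C hC
    have hLj : 0 ≤ Real.log Y ^ j := pow_nonneg hLY j
    gcongr
  have hsecond : ∀ {C : ℝ} {N : ℕ}, 0 ≤ C → C ≤ C₀ →
      (∑ k ∈ Icc 1 ⌊Y⌋₊, |a₂ k| * ellp Y k ^ j) * ((2 * η) * (Real.log Y ^ i *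
          (3 * (C + C * (1 + |Real.log (2 * α * Y ^ 2)|) ^ N) + 2 * C +
            C * (1 + |Real.log (2 * α * Y ^ 2)|) ^ N * (1 + |Real.log (2 * α * Y ^ 2)|)))) ≤
      (∑ k ∈ Icc 1 ⌊Y⌋₊, |a₂ k| * ellp Y k ^ j) * ((2 * η) * (Real.log Y ^ i *
          (3 * (C₀ + C₀ * (1 + |Real.log (2 * α * Y ^ 2)|) ^ N) + 2 * C₀ +
            C₀ * (1 + |Real.log (2 * α * Y ^ 2)|) ^ N * (1 + |Real.log (2 * α * Y ^ 2)|)))) := by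
    intro C N hC hCC
    have hLi : 0 ≤ Real.log Y ^ i := pow_nonneg hLY i
    have hxN : 0 ≤ (1 + |Real.log (2 * α * Y ^ 2)|) ^ N := pow_nonneg (by positivity) N
    gcongr
  refine ⟨?_, ?_, ?_, ?_, ?_, ?_⟩
  · have h := h₃₄ a₁ a₂ Y α B η K₁ i j hY hα hi hj hB hη hY₁
    have h' := le_trans h (add_le_add (hfirst e₃₄) (hsecond hC₃₄ e₃₄))
    have h'' := weaken_second_term10 hSj hη0 hLY hC₀0 hx (by norm_num : 3 + 4 + 1 ≤ 9) h'
    refine le_trans (le_of_eq ?_) h''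
    congr 1
    refine Finset.sum_congr rfl fun k₁ _ ↦ Finset.sum_congr rfl fun k₂ _ ↦ ?_
    simp only [Finset.sum_range_succ, Finset.sum_range_zero, zero_add, add_zero, Nat.choose_self,
      Nat.choose_zero_right, Nat.choose_one_right, hc32, hc42, hc43, Nat.cast_one, Nat.cast_ofNat, Nat.sub_self, Nat.sub_zero,
      Nat.reduceSub, Nat.reduceAdd, Nat.cast_zero, Nat.cast_add, pow_zero, pow_one, one_mul, mul_one,
      integral_model_weight_Ioc]
    ring
  · have h := h₄₀ a₁ a₂ Y α B η K₁ i j hY hα hi hj hB hη hY₁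
    have h' := le_trans h (add_le_add (hfirst e₄₀) (hsecond hC₄₀ e₄₀))
    have h'' := weaken_second_term10 hSj hη0 hLY hC₀0 hx (by norm_num : 4 + 0 + 1 ≤ 9) h'
    refine le_trans (le_of_eq ?_) h''
    congr 1
    refine Finset.sum_congr rfl fun k₁ _ ↦ Finset.sum_congr rfl fun k₂ _ ↦ ?_
    simp only [Finset.sum_range_succ, Finset.sum_range_zero, zero_add, add_zero, Nat.choose_self,
      Nat.choose_zero_right, Nat.choose_one_right, hc42, hc43, Nat.cast_one, Nat.cast_ofNat, Nat.sub_self, Nat.sub_zero,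
      Nat.reduceSub, Nat.reduceAdd, Nat.cast_zero, Nat.cast_add, pow_zero, pow_one, one_mul, mul_one,
      integral_model_weight_Ioc]
    ring
  · have h := h₄₁ a₁ a₂ Y α B η K₁ i j hY hα hi hj hB hη hY₁
    have h' := le_trans h (add_le_add (hfirst e₄₁) (hsecond hC₄₁ e₄₁))
    have h'' := weaken_second_term10 hSj hη0 hLY hC₀0 hx (by norm_num : 4 + 1 + 1 ≤ 9) h'
    refine le_trans (le_of_eq ?_) h''
    congr 1
    refine Finset.sum_congr rfl fun k₁ _ ↦ Finset.sum_congr rfl fun k₂ _ ↦ ?_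
    simp only [Finset.sum_range_succ, Finset.sum_range_zero, zero_add, add_zero, Nat.choose_self,
      Nat.choose_zero_right, Nat.choose_one_right, hc42, hc43, Nat.cast_one, Nat.cast_ofNat, Nat.sub_self, Nat.sub_zero,
      Nat.reduceSub, Nat.reduceAdd, Nat.cast_zero, Nat.cast_add, pow_zero, pow_one, one_mul, mul_one,
      integral_model_weight_Ioc]
    ring
  · have h := h₄₂ a₁ a₂ Y α B η K₁ i j hY hα hi hj hB hη hY₁
    have h' := le_trans h (add_le_add (hfirst e₄₂) (hsecond hC₄₂ e₄₂))
    have h'' := weaken_second_term10 hSj hη0 hLY hC₀0 hx (by norm_num : 4 + 2 + 1 ≤ 9) h'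
    refine le_trans (le_of_eq ?_) h''
    congr 1
    refine Finset.sum_congr rfl fun k₁ _ ↦ Finset.sum_congr rfl fun k₂ _ ↦ ?_
    simp only [Finset.sum_range_succ, Finset.sum_range_zero, zero_add, add_zero, Nat.choose_self,
      Nat.choose_zero_right, Nat.choose_one_right, hc42, hc43, Nat.cast_one, Nat.cast_ofNat, Nat.sub_self, Nat.sub_zero,
      Nat.reduceSub, Nat.reduceAdd, Nat.cast_zero, Nat.cast_add, pow_zero, pow_one, one_mul, mul_one,
      integral_model_weight_Ioc]
    ring
  · have h := h₄₃ a₁ a₂ Y α B η K₁ i j hY hα hi hj hB hη hY₁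
    have h' := le_trans h (add_le_add (hfirst e₄₃) (hsecond hC₄₃ e₄₃))
    have h'' := weaken_second_term10 hSj hη0 hLY hC₀0 hx (by norm_num : 4 + 3 + 1 ≤ 9) h'
    refine le_trans (le_of_eq ?_) h''
    congr 1
    refine Finset.sum_congr rfl fun k₁ _ ↦ Finset.sum_congr rfl fun k₂ _ ↦ ?_
    simp only [Finset.sum_range_succ, Finset.sum_range_zero, zero_add, add_zero, Nat.choose_self,
      Nat.choose_zero_right, Nat.choose_one_right, hc32, hc42, hc43, Nat.cast_one, Nat.cast_ofNat, Nat.sub_self, Nat.sub_zero,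
      Nat.reduceSub, Nat.reduceAdd, Nat.cast_zero, Nat.cast_add, pow_zero, pow_one, one_mul, mul_one,
      integral_model_weight_Ioc]
    ring
  · have h := h₄₄ a₁ a₂ Y α B η K₁ i j hY hα hi hj hB hη hY₁
    have h' := le_trans h (add_le_add (hfirst e₄₄) (hsecond hC₄₄ e₄₄))
    have h'' := weaken_second_term10 hSj hη0 hLY hC₀0 hx (by norm_num : 4 + 4 + 1 ≤ 9) h'
    refine le_trans (le_of_eq ?_) h''
    congr 1
    refine Finset.sum_congr rfl fun k₁ _ ↦ Finset.sum_congr rfl fun k₂ _ ↦ ?_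
    simp only [Finset.sum_range_succ, Finset.sum_range_zero, zero_add, add_zero, Nat.choose_self,
      Nat.choose_zero_right, Nat.choose_one_right, hc42, hc43, Nat.cast_one, Nat.cast_ofNat, Nat.sub_self, Nat.sub_zero,
      Nat.reduceSub, Nat.reduceAdd, Nat.cast_zero, Nat.cast_add, pow_zero, pow_one, one_mul, mul_one,
      integral_model_weight_Ioc]
    ring

end Summit.Parity.GeneralizedHardyLittlewood.Theorems.MomentsBeyondDiagonal.DiagCorner

end
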